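import Literature.MathematicalPhysics.QuantumLattice.SpinTwistedHubbardTorus
import HarnessLib

/-!
# A cutting plane of the even fermionic torus in any dimension: halves, reflection, cut bonds

Support file for Lieb's reflection-positivity lemma for the Peierls–Hubbard Hamiltonian
(E. H. Lieb, *Flux phase of the half-filled band*, PRL **73** (1994) 2158, Lemma, eq. (6)) in the
geometry of an ARBITRARY dimension `d + 1 ≥ 1` — the tree's `LiebFluxPhaseTorus.lean` is the
square torus `d + 1 = 2`; the case `d + 1 = 1` is the RING of Lieb–Nachtergaele, *Stability of the
Peierls instability for ring-shaped molecules*, Phys. Rev. B **51** (1995) 4777, §3 ("the plane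
intersecting the bonds `{L, 1}` and `{L/2, L/2 + 1}`", Fig. 1). Lieb cuts the lattice by a
hyperplane `P` into two halves that "are required to be mirror images of each other"; "the usual
square lattice with periodic boundary conditions is included" [Lieb1994, p. 2].
For the fermionic torus `FermionTorus (d + 1) L = (ℤ/Lℤ)^{d+1}` (`L` even) and the plane `P`
between the layers `L/2 - 1 | L/2` and `L - 1 | 0` of coordinate `0` this file provides:

* `col x` — coordinate `0` (as a natural `< L`); `IsLeft L x : col x < L/2` (the left half) and
  its complement, the right half;
* `reflect x` — the geometric reflection `R` through `P`, `x₀ ↦ L - 1 - x₀`, the other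
  coordinates fixed: an involution exchanging the halves (`isLeft_reflect_iff`), an automorphism
  of the nearest-neighbour torus graph (`adj_reflect_iff`), and the bijection `leftEquivRight`;
* the **cut bonds**: a left site `x` and a right site `y` are adjacent iff `x` lies on a boundary
  layer `col x ∈ {L/2 - 1, 0}` (`IsBoundary`) and `y = reflect x` (`adj_iff_isBoundary_and_eq_reflect`,
  `4 ≤ L`), and the corresponding one-term sums `sum_right_adj_eq`.

All statements and proofs are those of `LiebFluxPhaseTorus.lean` with the row coordinate replaced
by the `d` coordinates `1, …, d` (which the reflection fixes).

## References

* [Lieb1994] E. H. Lieb, Phys. Rev. Lett. 73 (1994) 2158, p. 2 (cutting hyperplanes `P`, mirror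
  halves, periodic boundary conditions "in any dimension"), p. 3 and Fig. 1 (pairs `l, r`).
* [LiebNachtergaele1995] E. H. Lieb, B. Nachtergaele, Phys. Rev. B 51 (1995) 4777
  (= arXiv:cond-mat/9410100), §3 and Fig. 1 (the ring, `d + 1 = 1`).
-/

noncomputable section

namespace Literature.MathematicalPhysics.QuantumLattice

open Matrix Finset HubbardWave0 Literature.Probability.LatticeModels

namespace FermionTorus

namespace Cut

variable {d L : ℕ}

/-! ### Coordinates -/

/-- The cut coordinate (coordinate `0`) of a site of the torus `(ℤ/Lℤ)^{d+1}`, as a natural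
number `< L`. [cite: Lieb1994, pp. 2–3 (cutting plane `P`, reflection `R`)] -/
def col (x : FermionTorus (d + 1) L) : ℕ := (ofLex x 0 : ℕ)

/-- `col x < L`. [cite: Lieb1994, pp. 2–3 (cutting plane `P`, reflection `R`)] -/
theorem col_lt (x : FermionTorus (d + 1) L) : col x < L := (ofLex x 0).isLt

/-- Unfolding lemma. [cite: Lieb1994, pp. 2–3 (cutting plane `P`, reflection `R`)] -/
theorem col_eq (x : FermionTorus (d + 1) L) : col x = (ofLex x 0 : ℕ) := rfl

/-- Two sites are equal iff their cut coordinates and their transverse coordinates agree.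
[cite: Lieb1994, pp. 2–3 (cutting plane `P`, reflection `R`)] -/
theorem ext_iff' {x y : FermionTorus (d + 1) L} :
    x = y ↔ col x = col y ∧ ∀ i : Fin d, ofLex x i.succ = ofLex y i.succ := by
  constructor
  · rintro rfl
    exact ⟨rfl, fun _ => rfl⟩
  · rintro ⟨h0, h1⟩
    refine (toLex_ofLex x).symm.trans ((congrArg toLex ?_).trans (toLex_ofLex y))
    funext i
    refine Fin.cases ?_ (fun j => ?_) i
    · exact Fin.ext h0
    · exact h1 j

/-! ### The left half -/

/-- **The left half-torus**: the sites in the layers `0, …, L/2 - 1` of coordinate `0`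
("left half", [Lieb1994, p. 2]; the sites `1, …, L/2` of the ring of [LiebNachtergaele1995] §3,
Fig. 1, counted from `0`). Reducible, so that `if IsLeft L x then … else …` finds its
decidability instance. [cite: Lieb1994, p. 2] -/
abbrev IsLeft (L : ℕ) (x : FermionTorus (d + 1) L) : Prop := col x < L / 2

/-- Unfolding lemma. [cite: Lieb1994, pp. 2–3 (cutting plane `P`, reflection `R`)] -/
theorem isLeft_iff (x : FermionTorus (d + 1) L) : IsLeft L x ↔ col x < L / 2 := Iff.rfl

/-- **The boundary layers of the left half**: `col x = L/2 - 1` (next to the cut `L/2 - 1 | L/2`)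
or `col x = 0` (next to the cut `L - 1 | 0`). [cite: Lieb1994, p. 3 and Fig. 1] -/
abbrev IsBoundary (L : ℕ) (x : FermionTorus (d + 1) L) : Prop := col x + 1 = L / 2 ∨ col x = 0

/-- Unfolding lemma. [cite: Lieb1994, pp. 2–3 (cutting plane `P`, reflection `R`)] -/
theorem isBoundary_iff (x : FermionTorus (d + 1) L) :
    IsBoundary L x ↔ col x + 1 = L / 2 ∨ col x = 0 := Iff.rfl

/-! ### The reflection through the cutting plane -/

/-- **The geometric reflection `R` through the cutting plane `P`**: `x₀ ↦ L - 1 - x₀`, the other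
coordinates fixed; it exchanges the layers `L/2 - 1 ↔ L/2` and `0 ↔ L - 1`.
[cite: Lieb1994, p. 3 (reflection `R` through `P`)] -/
def reflect (x : FermionTorus (d + 1) L) : FermionTorus (d + 1) L :=
  toLex (Function.update (ofLex x) 0 (Fin.rev (ofLex x 0)))

/-- The cut coordinate of the mirror image. [cite: Lieb1994, pp. 2–3 (cutting plane `P`, reflection `R`)] -/
theorem col_reflect (x : FermionTorus (d + 1) L) : col (reflect x) = L - 1 - col x := by
  simp only [col, reflect, ofLex_toLex, Function.update_self, Fin.val_rev]
  omega

/-- The transverse coordinates of the mirror image. [cite: Lieb1994, pp. 2–3 (cutting plane `P`, reflection `R`)] -/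
theorem ofLex_reflect_succ (x : FermionTorus (d + 1) L) (i : Fin d) :
    ofLex (reflect x) i.succ = ofLex x i.succ := by
  simp only [reflect, ofLex_toLex, Function.update_of_ne (Fin.succ_ne_zero i)]

/-- `R² = 1`. [cite: Lieb1994, pp. 2–3 (cutting plane `P`, reflection `R`)] -/
theorem reflect_reflect (x : FermionTorus (d + 1) L) : reflect (reflect x) = x := by
  rw [ext_iff', col_reflect, col_reflect]
  refine ⟨?_, fun i => ?_⟩
  · have := col_lt x
    omega
  · rw [ofLex_reflect_succ, ofLex_reflect_succ]

/-- The reflection as a permutation of the sites. [cite: Lieb1994, pp. 2–3 (cutting plane `P`, reflection `R`)] -/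
def reflectEquiv : FermionTorus (d + 1) L ≃ FermionTorus (d + 1) L :=
  Function.Involutive.toPerm reflect reflect_reflect

/-- `reflectEquiv x = reflect x`. [cite: Lieb1994, pp. 2–3 (cutting plane `P`, reflection `R`)] -/
@[simp] theorem reflectEquiv_apply (x : FermionTorus (d + 1) L) : reflectEquiv x = reflect x := rfl

/-- `reflectEquiv.symm x = reflect x`. [cite: Lieb1994, pp. 2–3 (cutting plane `P`, reflection `R`)] -/
@[simp] theorem reflectEquiv_symm_apply (x : FermionTorus (d + 1) L) :
    reflectEquiv.symm x = reflect x := rfl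

/-- **The reflection exchanges the two halves** (`L` even). [cite: Lieb1994, p. 2 (mirror images)] -/
theorem isLeft_reflect_iff (hL : Even L) (x : FermionTorus (d + 1) L) :
    IsLeft L (reflect x) ↔ ¬IsLeft L x := by
  rw [isLeft_iff, isLeft_iff, col_reflect]
  have := col_lt x
  obtain ⟨k, rfl⟩ := hL
  omega

/-- The bijection between the left and the right half induced by the reflection.
[cite: Lieb1994, p. 3 (left, right image pairs)] -/
def leftEquivRight (hL : Even L) :
    {x : FermionTorus (d + 1) L // IsLeft L x} ≃ {x : FermionTorus (d + 1) L // ¬IsLeft L x} where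
  toFun a := ⟨reflect a.1, (isLeft_reflect_iff hL a.1).not.2 (not_not.2 a.2)⟩
  invFun b := ⟨reflect b.1, (isLeft_reflect_iff hL b.1).2 b.2⟩
  left_inv a := Subtype.ext (reflect_reflect a.1)
  right_inv b := Subtype.ext (reflect_reflect b.1)

/-- `leftEquivRight a = reflect a`. [cite: Lieb1994, pp. 2–3 (cutting plane `P`, reflection `R`)] -/
@[simp] theorem leftEquivRight_apply (hL : Even L) (a : {x : FermionTorus (d + 1) L // IsLeft L x}) :
    (leftEquivRight hL a : FermionTorus (d + 1) L) = reflect a.1 := rfl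

/-- `(leftEquivRight)⁻¹ b = reflect b`. [cite: Lieb1994, pp. 2–3 (cutting plane `P`, reflection `R`)] -/
@[simp] theorem leftEquivRight_symm_apply (hL : Even L)
    (b : {x : FermionTorus (d + 1) L // ¬IsLeft L x}) :
    ((leftEquivRight hL).symm b : FermionTorus (d + 1) L) = reflect b.1 := rfl

/-- Boundary sites are left sites (`L ≥ 4`). [cite: Lieb1994, pp. 2–3 (cutting plane `P`, reflection `R`)] -/
theorem IsBoundary.isLeft (h4 : 4 ≤ L) {x : FermionTorus (d + 1) L} (hx : IsBoundary L x) :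
    IsLeft L x := by
  rw [isBoundary_iff] at hx
  rw [isLeft_iff]
  omega

/-- The mirror image of a boundary site is a right site. [cite: Lieb1994, pp. 2–3 (cutting plane `P`, reflection `R`)] -/
theorem IsBoundary.not_isLeft_reflect (hL : Even L) (h4 : 4 ≤ L) {x : FermionTorus (d + 1) L}
    (hx : IsBoundary L x) : ¬IsLeft L (reflect x) :=
  (isLeft_reflect_iff hL x).not.2 (not_not.2 (hx.isLeft h4))

/-! ### The reflection and the shifts, through the comparison with `(ZMod L)^{d+1}` -/

/-- Cut coordinate of the mirror image in `ZMod L`: `(R x)₀ = -x₀ - 1`. [cite: Lieb1994, pp. 2–3 (cutting plane `P`, reflection `R`)] -/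
theorem toTorusSite_reflect_zero (x : FermionTorus (d + 1) L) :
    toTorusSite (reflect x) 0 = -toTorusSite x 0 - 1 := by
  rw [toTorusSite_apply, toTorusSite_apply]
  simp only [reflect, ofLex_toLex, Function.update_self, Fin.val_rev]
  rw [Nat.cast_sub (show (ofLex x 0 : ℕ) + 1 ≤ L from (ofLex x 0).isLt), ZMod.natCast_self,
    Nat.cast_add, Nat.cast_one]
  ring

/-- Transverse coordinates of the mirror image in `ZMod L`: `(R x)ᵢ = xᵢ`, `i ≠ 0`. [cite: Lieb1994, pp. 2–3 (cutting plane `P`, reflection `R`)] -/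
theorem toTorusSite_reflect_succ (x : FermionTorus (d + 1) L) (i : Fin d) :
    toTorusSite (reflect x) i.succ = toTorusSite x i.succ := by
  rw [toTorusSite_apply, toTorusSite_apply, ofLex_reflect_succ]

section Shifts

variable [NeZero L]

/-- The cut coordinate of `x + e₀`. [cite: Lieb1994, pp. 2–3 (cutting plane `P`, reflection `R`)] -/
theorem col_shift_zero (x : FermionTorus (d + 1) L) : col (shift x 0) = (col x + 1 % L) % L := by
  simp only [col, shift, ofLex_toLex, Function.update_self, Fin.val_add, Fin.val_one']

/-- The cut coordinate of `x + eᵢ`, `i ≠ 0`. [cite: Lieb1994, pp. 2–3 (cutting plane `P`, reflection `R`)] -/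
theorem col_shift_succ (x : FermionTorus (d + 1) L) (i : Fin d) : col (shift x i.succ) = col x := by
  simp only [col, shift, ofLex_toLex, Function.update_of_ne (Fin.succ_ne_zero i).symm]

/-- The cut coordinate of `x - e₀`. [cite: Lieb1994, pp. 2–3 (cutting plane `P`, reflection `R`)] -/
theorem col_unshift_zero (x : FermionTorus (d + 1) L) :
    col (unshift x 0) = (L - 1 % L + col x) % L := by
  simp only [col, unshift, ofLex_toLex, Function.update_self, Fin.val_sub, Fin.val_one']

/-- The cut coordinate of `x - eᵢ`, `i ≠ 0`. [cite: Lieb1994, pp. 2–3 (cutting plane `P`, reflection `R`)] -/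
theorem col_unshift_succ (x : FermionTorus (d + 1) L) (i : Fin d) :
    col (unshift x i.succ) = col x := by
  simp only [col, unshift, ofLex_toLex, Function.update_of_ne (Fin.succ_ne_zero i).symm]

/-- The reflection reverses the shift along the cut coordinate: `R(x + e₀) = R x - e₀`. [cite: Lieb1994, pp. 2–3 (cutting plane `P`, reflection `R`)] -/
theorem reflect_shift_zero (x : FermionTorus (d + 1) L) : reflect (shift x 0) = unshift (reflect x) 0 := by
  apply toTorusSite_injective
  funext i
  refine Fin.cases ?_ (fun j => ?_) i
  · rw [toTorusSite_reflect_zero, toTorusSite_shift, toTorusSite_unshift, Pi.add_apply, Pi.sub_apply,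
      toTorusSite_reflect_zero, Pi.single_eq_same]
    ring
  · rw [toTorusSite_reflect_succ, toTorusSite_shift, toTorusSite_unshift, Pi.add_apply, Pi.sub_apply,
      toTorusSite_reflect_succ, Pi.single_eq_of_ne (Fin.succ_ne_zero j)]
    ring

/-- The reflection preserves the transverse shifts: `R(x + eᵢ) = R x + eᵢ`, `i ≠ 0`. [cite: Lieb1994, pp. 2–3 (cutting plane `P`, reflection `R`)] -/
theorem reflect_shift_succ (x : FermionTorus (d + 1) L) (i : Fin d) :
    reflect (shift x i.succ) = shift (reflect x) i.succ := by
  apply toTorusSite_injective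
  funext k
  refine Fin.cases ?_ (fun j => ?_) k
  · rw [toTorusSite_reflect_zero, toTorusSite_shift, toTorusSite_shift, Pi.add_apply, Pi.add_apply,
      toTorusSite_reflect_zero, Pi.single_eq_of_ne (Fin.succ_ne_zero i).symm]
    ring
  · rw [toTorusSite_reflect_succ, toTorusSite_shift, toTorusSite_shift, Pi.add_apply, Pi.add_apply,
      toTorusSite_reflect_succ]

/-- `R(x - e₀) = R x + e₀`. [cite: Lieb1994, pp. 2–3 (cutting plane `P`, reflection `R`)] -/
theorem reflect_unshift_zero (x : FermionTorus (d + 1) L) : reflect (unshift x 0) = shift (reflect x) 0 := by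
  apply toTorusSite_injective
  funext i
  refine Fin.cases ?_ (fun j => ?_) i
  · rw [toTorusSite_reflect_zero, toTorusSite_shift, toTorusSite_unshift, Pi.add_apply, Pi.sub_apply,
      toTorusSite_reflect_zero, Pi.single_eq_same]
    ring
  · rw [toTorusSite_reflect_succ, toTorusSite_shift, toTorusSite_unshift, Pi.add_apply, Pi.sub_apply,
      toTorusSite_reflect_succ, Pi.single_eq_of_ne (Fin.succ_ne_zero j)]
    ring

/-- `R(x - eᵢ) = R x - eᵢ`, `i ≠ 0`. [cite: Lieb1994, pp. 2–3 (cutting plane `P`, reflection `R`)] -/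
theorem reflect_unshift_succ (x : FermionTorus (d + 1) L) (i : Fin d) :
    reflect (unshift x i.succ) = unshift (reflect x) i.succ := by
  apply toTorusSite_injective
  funext k
  refine Fin.cases ?_ (fun j => ?_) k
  · rw [toTorusSite_reflect_zero, toTorusSite_unshift, toTorusSite_unshift, Pi.sub_apply, Pi.sub_apply,
      toTorusSite_reflect_zero, Pi.single_eq_of_ne (Fin.succ_ne_zero i).symm]
    ring
  · rw [toTorusSite_reflect_succ, toTorusSite_unshift, toTorusSite_unshift, Pi.sub_apply, Pi.sub_apply,
      toTorusSite_reflect_succ]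

/-- **The reflection is an automorphism of the nearest-neighbour torus graph** (`L ≥ 2`).
[cite: Lieb1994, p. 2 ("mirror images of each other")] -/
theorem adj_reflect_iff (hL : 2 ≤ L) (x y : FermionTorus (d + 1) L) :
    (fermionTorusGraph (d + 1) L).Adj (reflect x) (reflect y) ↔ (fermionTorusGraph (d + 1) L).Adj x y := by
  have key : ∀ x y : FermionTorus (d + 1) L, (fermionTorusGraph (d + 1) L).Adj x y →
      (fermionTorusGraph (d + 1) L).Adj (reflect x) (reflect y) := by
    intro x y h
    rcases (adj_iff_shift_or_unshift hL x y).1 h with ⟨μ, rfl⟩ | ⟨μ, rfl⟩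
    · induction μ using Fin.cases with
      | zero =>
        rw [reflect_shift_zero]
        exact adj_unshift hL _ 0
      | succ j =>
        rw [reflect_shift_succ]
        exact adj_shift hL _ j.succ
    · induction μ using Fin.cases with
      | zero =>
        rw [reflect_unshift_zero]
        exact adj_shift hL _ 0
      | succ j =>
        rw [reflect_unshift_succ]
        exact adj_unshift hL _ j.succ
  refine ⟨fun h => ?_, key x y⟩
  have h' := key _ _ h
  rwa [reflect_reflect, reflect_reflect] at h'

/-- On the boundary layer `L/2 - 1` the mirror image is the forward neighbour: `R x = x + e₀`.
[cite: Lieb1994, p. 3 (the pair `l, r` cut by `P`)] -/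
theorem reflect_eq_shift_of_col (hL : Even L) {x : FermionTorus (d + 1) L} (hx : col x + 1 = L / 2) :
    reflect x = shift x 0 := by
  obtain ⟨k, hk⟩ := hL
  have hcast : (2 : ZMod L) * ((((ofLex x 0 : ℕ) : ZMod L)) + 1) = 0 := by
    have h1 : (((ofLex x 0 : ℕ) + 1 : ℕ) : ZMod L) = (k : ZMod L) := by
      rw [show (ofLex x 0 : ℕ) + 1 = k by change col x + 1 = k; omega]
    have h2 : ((k + k : ℕ) : ZMod L) = 0 := by rw [← hk, ZMod.natCast_self]
    push_cast at h1 h2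
    linear_combination h2 + 2 * h1
  apply toTorusSite_injective
  funext i
  refine Fin.cases ?_ (fun j => ?_) i
  · rw [toTorusSite_reflect_zero, toTorusSite_shift, Pi.add_apply, Pi.single_eq_same, toTorusSite_apply]
    linear_combination -hcast
  · rw [toTorusSite_reflect_succ, toTorusSite_shift, Pi.add_apply,
      Pi.single_eq_of_ne (Fin.succ_ne_zero j), add_zero]

/-- On the boundary layer `0` the mirror image is the backward neighbour across the seam:
`R x = x - e₀`. [cite: Lieb1994, p. 3 (the pair `l, r` cut by `P`)] -/
theorem reflect_eq_unshift_of_col_zero {x : FermionTorus (d + 1) L} (hx : col x = 0) :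
    reflect x = unshift x 0 := by
  have h0 : toTorusSite x 0 = 0 := by
    rw [toTorusSite_apply, show (ofLex x 0 : ℕ) = 0 from hx, Nat.cast_zero]
  apply toTorusSite_injective
  funext i
  refine Fin.cases ?_ (fun j => ?_) i
  · rw [toTorusSite_reflect_zero, toTorusSite_unshift, Pi.sub_apply, Pi.single_eq_same, h0]
    ring
  · rw [toTorusSite_reflect_succ, toTorusSite_unshift, Pi.sub_apply,
      Pi.single_eq_of_ne (Fin.succ_ne_zero j), sub_zero]

/-- **The cut bonds.** For `L` even, `L ≥ 4`, a left site `x` and a right site `y` are nearest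
neighbours iff `x` is on a boundary layer and `y = R x` is its mirror image.
[cite: Lieb1994, p. 3 and Fig. 1 (generic left–right pair `l, r` cut by `P`)] -/
theorem adj_iff_isBoundary_and_eq_reflect (hL : Even L) (h4 : 4 ≤ L) {x y : FermionTorus (d + 1) L}
    (hx : IsLeft L x) (hy : ¬IsLeft L y) :
    (fermionTorusGraph (d + 1) L).Adj x y ↔ IsBoundary L x ∧ y = reflect x := by
  have h2 : 2 ≤ L := by omega
  rw [isLeft_iff] at hx hy
  have hcx := col_lt x
  constructor
  · intro h
    rcases (adj_iff_shift_or_unshift h2 x y).1 h with ⟨μ, rfl⟩ | ⟨μ, rfl⟩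
    · induction μ using Fin.cases with
      | zero =>
        -- `y = x + e₀`
        rw [col_shift_zero, Nat.mod_eq_of_lt (show 1 < L by omega),
          Nat.mod_eq_of_lt (show col x + 1 < L by omega)] at hy
        have hb : col x + 1 = L / 2 := by omega
        exact ⟨Or.inl hb, (reflect_eq_shift_of_col hL hb).symm⟩
      | succ j =>
        -- `y = x + eⱼ` stays in the same layer
        rw [col_shift_succ] at hy
        exact absurd hx hy
    · induction μ using Fin.cases with
      | zero =>
        -- `y = x - e₀`
        rw [col_unshift_zero, Nat.mod_eq_of_lt (show 1 < L by omega)] at hy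
        have hb : col x = 0 := by
          by_contra hne
          rw [show L - 1 + col x = (col x - 1) + L by omega, Nat.add_mod_right,
            Nat.mod_eq_of_lt (show col x - 1 < L by omega)] at hy
          omega
        exact ⟨Or.inr hb, (reflect_eq_unshift_of_col_zero hb).symm⟩
      | succ j =>
        rw [col_unshift_succ] at hy
        exact absurd hx hy
  · rintro ⟨hb | hb, rfl⟩
    · rw [reflect_eq_shift_of_col hL hb]
      exact adj_shift h2 x 0
    · rw [reflect_eq_unshift_of_col_zero hb]
      exact adj_unshift h2 x 0

/-- **Summing over the cut bonds.** For a left site `a`, the sum over the right sites adjacent to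
`a` has at most the one term `R a`:
`Σ_{b ∈ R} [a ∼ b] f b = [a ∈ boundary] f (R a)`. [cite: Lieb1994, p. 3 (pairs `l, r`)] -/
theorem sum_right_adj_eq (hL : Even L) (h4 : 4 ≤ L) {M : Type*} [AddCommMonoid M]
    (a : {x : FermionTorus (d + 1) L // IsLeft L x})
    (f : {x : FermionTorus (d + 1) L // ¬IsLeft L x} → M) :
    (∑ b : {x : FermionTorus (d + 1) L // ¬IsLeft L x},
        if (fermionTorusGraph (d + 1) L).Adj a.1 b.1 then f b else 0) =
      if IsBoundary L a.1 then f (leftEquivRight hL a) else 0 := by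
  by_cases hb : IsBoundary L a.1
  · rw [if_pos hb, Finset.sum_eq_single (leftEquivRight hL a)]
    · rw [if_pos ((adj_iff_isBoundary_and_eq_reflect hL h4 a.2 (leftEquivRight hL a).2).2 ⟨hb, rfl⟩)]
    · intro b _ hne
      rw [if_neg]
      intro hadj
      have h := ((adj_iff_isBoundary_and_eq_reflect hL h4 a.2 b.2).1 hadj).2
      exact hne (Subtype.ext h)
    · exact fun h => absurd (Finset.mem_univ _) h
  · rw [if_neg hb]
    refine Finset.sum_eq_zero fun b _ => ?_
    rw [if_neg]
    intro hadj
    exact hb ((adj_iff_isBoundary_and_eq_reflect hL h4 a.2 b.2).1 hadj).1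

/-- The same sum written from the right: `Σ_{b ∈ R} [b ∼ a] f b = [a ∈ boundary] f (R a)`.
[cite: Lieb1994, pp. 2–3 (cutting plane `P`, reflection `R`)] -/
theorem sum_right_adj_eq' (hL : Even L) (h4 : 4 ≤ L) {M : Type*} [AddCommMonoid M]
    (a : {x : FermionTorus (d + 1) L // IsLeft L x})
    (f : {x : FermionTorus (d + 1) L // ¬IsLeft L x} → M) :
    (∑ b : {x : FermionTorus (d + 1) L // ¬IsLeft L x},
        if (fermionTorusGraph (d + 1) L).Adj b.1 a.1 then f b else 0) =
      if IsBoundary L a.1 then f (leftEquivRight hL a) else 0 := by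
  rw [← sum_right_adj_eq hL h4 a f]
  refine Finset.sum_congr rfl fun b _ => ?_
  simp only [(fermionTorusGraph (d + 1) L).adj_comm]

end Shifts

end Cut

end FermionTorus

end Literature.MathematicalPhysics.QuantumLattice

end
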